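import Summits.BirchSwinnertonDyer.BirchSwinnertonDyer.Theorems.ErratumRoadFiveEulerHalfGenusSchemasDischarged
import Summits.BirchSwinnertonDyer.BirchSwinnertonDyer.Theorems.ErratumRoadFiveEulerHalfGenusClassDataSupplyOfPrintedFacts
import Summits.BirchSwinnertonDyer.BirchSwinnertonDyer.Theorems.ErratumRoadFiveEulerHalfGenusJetchevBookkeepingSwap
import HarnessLib

/-!
# Route `ErratumRoadFive`, crux `EulerHalfPOnlyMultPotMultTwinAtFive` (23444), line `genus` v2.3: child (b) and the crux BY NAME
# from {the eight ER5 items, the three printed Heegner-point facts, the SWAP SUPPLY in Zhang currency, (b2a) `GenusJetchev53`}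
# — (b1) `GenusMcCallum52` and (b2b) `GenusJetchevThm63` ∕ (b2b-κ) `GenusClassDataSupply` no longer appear
# (seat `bsd-idea-9` g27, line owner; helper `--supports stmt-BirchSwinnertonDyer-23444 --as helper`)

THEOREMS ONLY (no definition, no named fact, no `sorry`).  HONEST FRAMING: kernel glue; conditional on the displayed binders; the
research content of child (b) is now {`hswap` (the swap supply for the genus family in ZHANG currency — a tree theorem in GROSS
currency on every served frame, `ShimuraWalk.genusSwapSupplyAt_of_frameProfile`, imc-p1 g42 p734410, pending its transport),
(b2a) `GenusJetchev53` ([J] Prop. 5.3 for the family)} plus the three printed facts; BSD is proved for no curve; items 19715 ∕ 20529 ∕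
23444 stay open.

WHAT (line-owner currency decision D1–D3, bsd-stepL STATUS 2026-08-29 ≈17:25Z).
* `genusKolyvaginPointDivAtP_of_swap_of_prop53_of_thm63` — `GenusLine.genusKolyvaginPointDivAtP_of_twins` (TwinsGlue §1h, v1.8) VERBATIM
  with the frame-free bridge p704151 replaced by its swap-currency form `GenusKolyvagin.FrameFree.pointFamily_divisible_of_swap_of_prop53_of_thm63`
  (this seat, `…GenusJetchevBookkeepingSwap.lean`): binders `(hmodP) (hswap) (h53 : GenusJetchev53) (h63 : GenusJetchevThm63)`, where
  `hswap` is the swap supply in ZHANG currency on every served frame — for EVERY depth function `mdiv` on the square-free conductors on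
  Zhang–Kolyvagin primes of `(W, K, p)` characterised by the `p^u`-divisibility of all the family's points `genusFamilyPoint … δ`,
  `δ : GenusKolyvaginDatum … c`, the statement `∀ μ e c, μ+1 ≤ M(c) → (∀ c', μ+1 ≤ M(c') → μ ≤ mdiv c') → ¬ (μ+1 ≤ mdiv c) → ∃ c', e ≤ M(c') ∧
  ¬ (μ+1 ≤ mdiv c')` with `M := Zhang2014.levelIndex W p` (the TRANSPORT TARGET handed to imc-p1: Gross `frobLevelIndex` = Zhang `levelIndex` on
  Kolyvagin conductors of the frame, `GenusLine.gross_of_zhang_of_frameProfile` ∕ `GenusLine.zhang_isKolyvaginPrime_of_kolyvaginPrime`; `ShimuraWalk.mdiv`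
  of the labelled family ↔ the `∀ δ`-depth, adapter A `GenusLine.forall_genusDatum_pDiv_iff_pDiv`, p730113).
* `genusKolyvaginPointDivAtP_of_swap_of_prop53_of_printedFacts` — the same with `h63` DISCHARGED: `genusJetchevThm63_of_classDataSupply₀`
  (defn-ty1 g40 ∕ this seat, p732198) ∘ `genusClassDataSupply_of_printedFacts` (imc-p1 g42, p733501).
* `EulerHalfPOnlyMultPotMultTwinAtFive_of_printedFacts_of_swap_of_coreVertices` — the crux BY NAME from the eight ER5 items, `hG1 ∕ hNek ∕ hP53`,
  `hswap` and (b2a) (`EulerHalfPOnlyMultPotMultTwinAtFive_of_printedFacts_of_labelB`, modularity read from the item `NewformOfEllipticCurve` as in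
  TwinsGlue §2).  This is the `_of` of the v2.3 skeleton: stubs `stub_genusSwapZhang : <hswap>` (closable by the transport) and
  `stub_genusJetchev53 : GenusJetchev53`.
[cite: Jetchev2008, Thm. 1.4 (p. 812), §3.1 item 5 (p. 817), Prop. 5.3 (p. 823), Thm. 5.2 (p. 821), proof of Thm. 1.1 (p. 824)]
[cite: McCallumLMS1991, §5 Prop. 5.2 (p. 304)] [cite: GrossLMS1991, §3 (3.3), §4 Lemma 4.3] [cite: WZhang2014, Notations (xii)]
presearch: «Kolyvagin prime swap redefinition m_infinity genus Heegner points» → [corpus: Jetchev2008 §3.1 item 5; McCallumLMS1991 §5] frame-bound prose;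
`lean search 'genusKolyvaginPointDivAtP_of'` → `_of_twins` only (McCallum currency).
-/

set_option autoImplicit false

noncomputable section

namespace Summit.BirchSwinnertonDyer.BirchSwinnertonDyer.Theorems.GenusLine

open scoped Classical

open NumberField IsDedekindDomain Field Rat.HeightOneSpectrum
open WeierstrassCurve Literature.NumberTheory.EllipticCurves
  Literature.NumberTheory.EllipticCurves.ModularForms
  Literature.NumberTheory.EllipticCurves.CaiShuTian2014
  Literature.NumberTheory.EllipticCurves.Rank1Residual
  Literature.NumberTheory.EllipticCurves.Rank1Residual.Typed
  Literature.NumberTheory.GaloisRepresentations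
open Summit.BirchSwinnertonDyer.Rank1Residual
open Summit.BirchSwinnertonDyer.BirchSwinnertonDyer.Theorems
  Summit.BirchSwinnertonDyer.BirchSwinnertonDyer.Theorems.GenusGrossZagier
  Summit.BirchSwinnertonDyer.BirchSwinnertonDyer.Theorems.RamifiedTwinGenusHeegner
  Summit.BirchSwinnertonDyer.BirchSwinnertonDyer.Theorems.RamifiedTwinRamTransport

set_option linter.dupNamespace false

/-! ### §1 Child (b) from the swap supply (Zhang currency), (b2a) and (b2b) — PROVED -/

/-- **CHILD (b) FROM {swap supply, (b2a), (b2b)} — PROVED (v2.3).**  `GenusKolyvaginPointDivAtP` follows from the swap supply for the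
CM-presentation family in Zhang currency (`hswap`, universally over the characterised depth function — the binder shape of
`GenusKolyvagin.FrameFree.pointFamily_divisible_of_swap_of_prop53_of_thm63` at `IsK := Zhang2014.IsKolyvaginPrime N_W W K p`,
`Midx := Zhang2014.levelIndex W p`, `D c := GenusKolyvaginDatum …`, `P c δ := genusFamilyPoint … δ`), (b2a) `GenusJetchev53`, (b2b)
`GenusJetchevThm63` and modularity of `W` (read ONLY through `zhang_isKolyvaginPrime_of_kolyvaginPrime`).  Proof: `genusKolyvaginPointDivAtP_of_twins`
verbatim with the swap-currency bridge.  Conditional on the displayed binders; no summit statement is proved; BSD is proved for no curve.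
[cite: Jetchev2008, Thm. 1.4, §3.1 item 5, Prop. 5.3, Thm. 5.2, proof of Thm. 1.1 (p. 824)] [cite: GrossLMS1991, §3 (3.3)] -/
theorem genusKolyvaginPointDivAtP_of_swap_of_prop53_of_thm63 (hmodP : nonempty_modularParametrizationData)
    (hswap : ∀ (W : WeierstrassCurve ℚ) [W.IsElliptic] [W.IsGloballyMinimal]
      (A : WeierstrassCurve ℚ) [A.IsElliptic] [A.IsGloballyMinimal] (p q : ℕ) [Fact p.Prime] [Fact q.Prime]
      (K : Type) [Field K] [NumberField K] (S : GenusHeegnerSettingRC W A p q K),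
      FrameProfile W A p q K → (AddSubgroup.zmultiples S.P).index ≠ 0 →
      Finite (W.baseChange K).sha → ¬ IsOfFinAddOrder S.P →
      haveI := S.ell; haveI := S.min; haveI := S.nz; haveI := S.nf
      ∀ (mdiv : {c : ℕ // Squarefree c ∧
          ∀ ℓ ∈ c.primeFactors, Zhang2014.IsKolyvaginPrime (W.conductorNorm ℤ) W K p ℓ} → ℕ∞),
        (∀ c (u : ℕ), (u : ℕ∞) ≤ mdiv c ↔ ∀ δ : GenusKolyvaginDatum S.E' K S.ιc S.Dt S.β S.d₁ c.1,
          ∃ z : (W.baseChange (ringClassField K S.ιc c.1)).toAffine.Point,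
            ((p ^ u : ℕ) : ℤ) • z = genusFamilyPoint W S.E' S.D S.C₂ S.hWd K S.ιc δ) →
        ∀ (μ e : ℕ) (c : {c : ℕ // Squarefree c ∧
            ∀ ℓ ∈ c.primeFactors, Zhang2014.IsKolyvaginPrime (W.conductorNorm ℤ) W K p ℓ}),
          ((μ + 1 : ℕ) : ℕ∞) ≤ Zhang2014.levelIndex W p c.1 →
          (∀ c' : {c : ℕ // Squarefree c ∧
              ∀ ℓ ∈ c.primeFactors, Zhang2014.IsKolyvaginPrime (W.conductorNorm ℤ) W K p ℓ},
            ((μ + 1 : ℕ) : ℕ∞) ≤ Zhang2014.levelIndex W p c'.1 → (μ : ℕ∞) ≤ mdiv c') →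
          ¬ ((μ + 1 : ℕ) : ℕ∞) ≤ mdiv c →
          ∃ c' : {c : ℕ // Squarefree c ∧
              ∀ ℓ ∈ c.primeFactors, Zhang2014.IsKolyvaginPrime (W.conductorNorm ℤ) W K p ℓ},
            (e : ℕ∞) ≤ Zhang2014.levelIndex W p c'.1 ∧ ¬ ((μ + 1 : ℕ) : ℕ∞) ≤ mdiv c')
    (h53 : GenusJetchev53) (h63 : GenusJetchevThm63) : GenusKolyvaginPointDivAtP := by
  intro W _ _ A _ _ p q _ _ K _ _ S hprof hidx hsha hPinf
  haveI := S.ell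
  haveI := S.min
  haveI := S.nz
  haveI := S.nf
  intro M hM m hm hKol Q hQ ϑ' hϑ'2 hϑ'0 g T hg hT hT'
  have hp : p.Prime := Fact.out
  have hp2 : p ≠ 2 := by have := hprof.five_le; omega
  haveI : NeZero (W.conductorNorm ℤ) := ⟨(WeierstrassCurve.conductorNorm_pos_holds _).ne'⟩
  obtain ⟨DtW⟩ := hmodP W
  have hKolZ : ∀ ℓ ∈ m.primeFactors, Zhang2014.IsKolyvaginPrime (W.conductorNorm ℤ) W K p ℓ ∧
      M ≤ Zhang2014.kolyvaginIndex W p ℓ :=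
    fun ℓ h ↦ zhang_isKolyvaginPrime_of_kolyvaginPrime W DtW (hKol ℓ h).1 hM (hKol ℓ h).2
  haveI : ∀ k : ℕ, NumberField (ringClassField K S.ιc k) := fun k ↦ JET.numberField_ringClassField K hprof.quad S.ιc k
  obtain ⟨τ, hτ⟩ := JET.exists_algEquiv_ne_one_of_isImaginaryQuadratic K hprof.quad
  let δ : GenusKolyvaginDatum S.E' K S.ιc S.Dt S.β S.d₁ m := ⟨Q, hQ, ϑ', hϑ'2, hϑ'0, g, T, hg, hT, hT'⟩
  exact GenusKolyvagin.FrameFree.pointFamily_divisible_of_swap_of_prop53_of_thm63 hp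
    (Zhang2014.IsKolyvaginPrime (W.conductorNorm ℤ) W K p) (Zhang2014.kolyvaginIndex W p) (Zhang2014.levelIndex W p)
    (fun c s ↦ Zhang2014.natCast_le_levelIndex_iff) (D := fun c ↦ GenusKolyvaginDatum S.E' K S.ιc S.Dt S.β S.d₁ c)
    (fun c δ ↦ genusFamilyPoint W S.E' S.D S.C₂ S.hWd K S.ιc δ)
    (fun c hc _ R hR ↦ X11b.RingClassNoTorsion.eq_zero_of_zsmul_pow_eq_zero_ringClassField W hprof.quad S.ιc hc.ne_zero hp
      hp2 hprof.surj 1 R (by simpa using hR))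
    (fun k c ↦ Jetchev2008.IsGlobalCoreVertex W K S.ιc τ p k c) (padicValNat p W.tamagawaProduct)
    (hswap W A p q K S hprof hidx hsha hPinf) (h53 W A p q K S hprof hidx hsha hPinf τ hτ)
    (h63 W A p q K S hprof hidx hsha hPinf τ hτ) (min M (padicValNat p W.tamagawaProduct)) (min_le_right _ _) m δ hm
    (fun ℓ h ↦ ⟨(hKolZ ℓ h).1, (min_le_left _ _).trans (hKolZ ℓ h).2⟩)

/-- **CHILD (b) FROM {swap supply, (b2a)} AND THE THREE PRINTED HEEGNER-POINT FACTS — PROVED (v2.3).**  As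
`genusKolyvaginPointDivAtP_of_swap_of_prop53_of_thm63` with (b2b) DISCHARGED by `genusJetchevThm63_of_classDataSupply₀` (road K's two
local schemas proved, p732198) ∘ `genusClassDataSupply_of_printedFacts` (imc-p1 g42's closer, p733501: the class-data supply from Birch's
G1 `hG1`, Nekovář's CM congruence `hNek`, Gross's pinned Prop. 5.3 `hP53`).  Conditional on the displayed binders; no summit statement is
proved; BSD is proved for no curve.  [cite: Jetchev2008, Thm. 1.4, Prop. 5.3, Thm. 5.2] [cite: GrossZagier1986, I §6]
[cite: Nekovar2007, Prop. 2.10] [cite: GrossLMS1991, Prop. 5.3] -/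
theorem genusKolyvaginPointDivAtP_of_swap_of_prop53_of_printedFacts (hmodP : nonempty_modularParametrizationData)
    (hG1 : ∀ (N : ℕ) [NeZero N] (W : WeierstrassCurve ℚ) (K : Type) [Field K] [NumberField K],
      phi_heegnerPointOfConductor_mem_range_map_ringClassField_birch N W K)
    (hNek : Nekovar2007.cmPoint_frobeniusCongruence)
    (hP53 : ∀ (N : ℕ) [NeZero N] (W : WeierstrassCurve ℚ) (K : Type) [Field K] [NumberField K],
      GrossLMS1991.prop53_conj_pinned_birch N W K)
    (hswap : ∀ (W : WeierstrassCurve ℚ) [W.IsElliptic] [W.IsGloballyMinimal]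
      (A : WeierstrassCurve ℚ) [A.IsElliptic] [A.IsGloballyMinimal] (p q : ℕ) [Fact p.Prime] [Fact q.Prime]
      (K : Type) [Field K] [NumberField K] (S : GenusHeegnerSettingRC W A p q K),
      FrameProfile W A p q K → (AddSubgroup.zmultiples S.P).index ≠ 0 →
      Finite (W.baseChange K).sha → ¬ IsOfFinAddOrder S.P →
      haveI := S.ell; haveI := S.min; haveI := S.nz; haveI := S.nf
      ∀ (mdiv : {c : ℕ // Squarefree c ∧
          ∀ ℓ ∈ c.primeFactors, Zhang2014.IsKolyvaginPrime (W.conductorNorm ℤ) W K p ℓ} → ℕ∞),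
        (∀ c (u : ℕ), (u : ℕ∞) ≤ mdiv c ↔ ∀ δ : GenusKolyvaginDatum S.E' K S.ιc S.Dt S.β S.d₁ c.1,
          ∃ z : (W.baseChange (ringClassField K S.ιc c.1)).toAffine.Point,
            ((p ^ u : ℕ) : ℤ) • z = genusFamilyPoint W S.E' S.D S.C₂ S.hWd K S.ιc δ) →
        ∀ (μ e : ℕ) (c : {c : ℕ // Squarefree c ∧
            ∀ ℓ ∈ c.primeFactors, Zhang2014.IsKolyvaginPrime (W.conductorNorm ℤ) W K p ℓ}),
          ((μ + 1 : ℕ) : ℕ∞) ≤ Zhang2014.levelIndex W p c.1 →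
          (∀ c' : {c : ℕ // Squarefree c ∧
              ∀ ℓ ∈ c.primeFactors, Zhang2014.IsKolyvaginPrime (W.conductorNorm ℤ) W K p ℓ},
            ((μ + 1 : ℕ) : ℕ∞) ≤ Zhang2014.levelIndex W p c'.1 → (μ : ℕ∞) ≤ mdiv c') →
          ¬ ((μ + 1 : ℕ) : ℕ∞) ≤ mdiv c →
          ∃ c' : {c : ℕ // Squarefree c ∧
              ∀ ℓ ∈ c.primeFactors, Zhang2014.IsKolyvaginPrime (W.conductorNorm ℤ) W K p ℓ},
            (e : ℕ∞) ≤ Zhang2014.levelIndex W p c'.1 ∧ ¬ ((μ + 1 : ℕ) : ℕ∞) ≤ mdiv c')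
    (h53 : GenusJetchev53) : GenusKolyvaginPointDivAtP :=
  genusKolyvaginPointDivAtP_of_swap_of_prop53_of_thm63 hmodP hswap h53
    (genusJetchevThm63_of_classDataSupply₀ (genusClassDataSupply_of_printedFacts hG1 hNek hP53 hmodP))

/-! ### §2 The crux BY NAME from {eight ER5 items, three printed facts, swap supply, (b2a)} — PROVED (the `_of` of skeleton v2.3) -/

/-- **THE v2.3 SHAPE — PROVED, NO `sorry`-DEPENDENCE**: the eight ER5 items + the three printed Heegner-point facts (`hG1`, `hNek`, `hP53`)
+ the swap supply in Zhang currency (`hswap`) + (b2a) `GenusJetchev53` BY NAME → the crux BY NAME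
(`EulerHalfPOnlyMultPotMultTwinAtFive_of_printedFacts_of_labelB ∘ genusKolyvaginPointDivAtP_of_swap_of_prop53_of_printedFacts`; modularity of `W`
from the item `NewformOfEllipticCurve` exactly as in TwinsGlue §2).  (b1) `GenusMcCallum52`, (b2b) `GenusJetchevThm63`, (b2b-κ)
`GenusClassDataSupply` no longer occur.  Conditional on the displayed binders; `hswap` (pending imc-p1's Gross → Zhang transport of
`ShimuraWalk.genusSwapSupplyAt_of_frameProfile`) and (b2a) are the research ∕ transport content; BSD is proved for no curve.
[cite: Jetchev2008, Thm. 1.4, §3.1 item 5, Prop. 5.3, Thm. 5.2, Proof of Thm. 1.1] [cite: GrossLMS1991, §§3–6] [cite: McCallumLMS1991, §5] -/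
theorem EulerHalfPOnlyMultPotMultTwinAtFive_of_printedFacts_of_swap_of_coreVertices
    (hSk : Summit.BirchSwinnertonDyer.BirchSwinnertonDyer.Theses.ErratumRoadFive.SkinnerRankZeroPPart)
    (hGZK : Summit.BirchSwinnertonDyer.BirchSwinnertonDyer.Theses.ErratumRoadFive.RankEqAnalyticRankLeOne)
    (hmod : Summit.BirchSwinnertonDyer.BirchSwinnertonDyer.Theses.ErratumRoadFive.EntireLFunctionRat)
    (hnf : Summit.BirchSwinnertonDyer.BirchSwinnertonDyer.Theses.ErratumRoadFive.NewformOfEllipticCurve)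
    (hMaz : Summit.BirchSwinnertonDyer.BirchSwinnertonDyer.Theses.ErratumRoadFive.MazurManinConstantOddPrimes)
    (hGZ73 : Summit.BirchSwinnertonDyer.BirchSwinnertonDyer.Theses.ErratumRoadFive.GrossZagierRationalPointI73)
    (hHL : Summit.BirchSwinnertonDyer.BirchSwinnertonDyer.Theses.ErratumRoadFive.HoffsteinLuoNonvanishingTwist)
    (hCST : Summit.BirchSwinnertonDyer.BirchSwinnertonDyer.Theses.ErratumRoadFive.CaiShuTianGrossZagierRingClassChar)
    (hG1 : ∀ (N : ℕ) [NeZero N] (W : WeierstrassCurve ℚ) (K : Type) [Field K] [NumberField K],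
      phi_heegnerPointOfConductor_mem_range_map_ringClassField_birch N W K)
    (hNek : Nekovar2007.cmPoint_frobeniusCongruence)
    (hP53 : ∀ (N : ℕ) [NeZero N] (W : WeierstrassCurve ℚ) (K : Type) [Field K] [NumberField K],
      GrossLMS1991.prop53_conj_pinned_birch N W K)
    (hswap : ∀ (W : WeierstrassCurve ℚ) [W.IsElliptic] [W.IsGloballyMinimal]
      (A : WeierstrassCurve ℚ) [A.IsElliptic] [A.IsGloballyMinimal] (p q : ℕ) [Fact p.Prime] [Fact q.Prime]
      (K : Type) [Field K] [NumberField K] (S : GenusHeegnerSettingRC W A p q K),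
      FrameProfile W A p q K → (AddSubgroup.zmultiples S.P).index ≠ 0 →
      Finite (W.baseChange K).sha → ¬ IsOfFinAddOrder S.P →
      haveI := S.ell; haveI := S.min; haveI := S.nz; haveI := S.nf
      ∀ (mdiv : {c : ℕ // Squarefree c ∧
          ∀ ℓ ∈ c.primeFactors, Zhang2014.IsKolyvaginPrime (W.conductorNorm ℤ) W K p ℓ} → ℕ∞),
        (∀ c (u : ℕ), (u : ℕ∞) ≤ mdiv c ↔ ∀ δ : GenusKolyvaginDatum S.E' K S.ιc S.Dt S.β S.d₁ c.1,
          ∃ z : (W.baseChange (ringClassField K S.ιc c.1)).toAffine.Point,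
            ((p ^ u : ℕ) : ℤ) • z = genusFamilyPoint W S.E' S.D S.C₂ S.hWd K S.ιc δ) →
        ∀ (μ e : ℕ) (c : {c : ℕ // Squarefree c ∧
            ∀ ℓ ∈ c.primeFactors, Zhang2014.IsKolyvaginPrime (W.conductorNorm ℤ) W K p ℓ}),
          ((μ + 1 : ℕ) : ℕ∞) ≤ Zhang2014.levelIndex W p c.1 →
          (∀ c' : {c : ℕ // Squarefree c ∧
              ∀ ℓ ∈ c.primeFactors, Zhang2014.IsKolyvaginPrime (W.conductorNorm ℤ) W K p ℓ},
            ((μ + 1 : ℕ) : ℕ∞) ≤ Zhang2014.levelIndex W p c'.1 → (μ : ℕ∞) ≤ mdiv c') →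
          ¬ ((μ + 1 : ℕ) : ℕ∞) ≤ mdiv c →
          ∃ c' : {c : ℕ // Squarefree c ∧
              ∀ ℓ ∈ c.primeFactors, Zhang2014.IsKolyvaginPrime (W.conductorNorm ℤ) W K p ℓ},
            (e : ℕ∞) ≤ Zhang2014.levelIndex W p c'.1 ∧ ¬ ((μ + 1 : ℕ) : ℕ∞) ≤ mdiv c')
    (h53 : GenusJetchev53) :
    Summit.BirchSwinnertonDyer.BirchSwinnertonDyer.Theses.ErratumRoadFive.EulerHalfPOnlyMultPotMultTwinAtFive :=
  EulerHalfPOnlyMultPotMultTwinAtFive_of_printedFacts_of_labelB hSk hGZK hmod hnf hMaz hGZ73 hHL hCST hG1 hNek hP53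
    (genusKolyvaginPointDivAtP_of_swap_of_prop53_of_printedFacts
      (nonempty_modularParametrizationData_of_exists_isNewformOf hnf IsNewformOf.exists_maninConstant_ne_zero_holds)
      hG1 hNek hP53 hswap h53)

end Summit.BirchSwinnertonDyer.BirchSwinnertonDyer.Theorems.GenusLine

end
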